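import Literature.Probability.Process.BrownianMotion
import Literature.Probability.Process.KolmogorovChentsov
import Mathlib.Probability.Distributions.Gaussian.Real
import Mathlib.Probability.Moments.MGFAnalytic
import HarnessLib

/-!
# Brownian motion: discharges of the existence-layer named facts

This file proves (sorry-free) the named facts of `Literature.Probability.Process.BrownianMotion`
that concern the Kolmogorov–Chentsov step of the construction of Brownian motion:

* `ProbabilityTheory.IsKolmogorovProcess.exists_modification_continuous_holds` — the
  Kolmogorov–Chentsov continuity theorem on `ℝ≥0` (from
  `Literature.Probability.Process.exists_modification_continuous_of_isKolmogorovProcess`, dyadic proof following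
  Le Gall 2016, Thm 2.9);
* `ProbabilityTheory.IsAEKolmogorovProcess.exists_modification_continuous_holds'` — its
  unconditional `IsAEKolmogorovProcess` corollary;
* `ProbabilityTheory.IsPreBrownianReal.isAEKolmogorovProcess_holds` — a pre-Brownian motion
  satisfies the Kolmogorov condition with `(p, q, M) = (4, 2, 3)`, via the fourth Gaussian moment
  `∫ x ^ 4 d𝓝(0, v) = 3 v²` (`Literature.Probability.Process.integral_pow_four_gaussianReal`, computed from the fourth
  derivative of the moment generating function);
* `ProbabilityTheory.IsPreBrownianReal.exists_modification_isBrownianReal_holds` — every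
  pre-Brownian motion has a modification which is a Brownian motion with everywhere continuous
  paths, measurable marginals and `B 0 = 0` identically (Le Gall 2016, Cor 2.11;
  Degenne–Ledvinka–Marion–Pfaffelhuber, arXiv:2511.20118, §5, `IsPreBrownian.mk`).

## References

* J.-F. Le Gall, *Brownian Motion, Martingales, and Stochastic Calculus*, GTM 274 (2016),
  Thm 2.9, Cor 2.11.
* R. Degenne, D. Ledvinka, E. Marion, P. Pfaffelhuber, *Formalization of Brownian motion in Lean*,
  arXiv:2511.20118, §2.3, §2.4 (p. 9: `E[|X_t - X_s|^4] = 3 (t - s)^2`), Thm 4.21, §5.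
* O. Kallenberg, *Foundations of Modern Probability* (2002), Thm 3.23, Thm 13.5.
-/

open MeasureTheory ProbabilityTheory Filter Set
open scoped ENNReal NNReal Topology

namespace Literature.Probability.Process

/-! ### The fourth moment of a centred Gaussian -/

/-- Derivative of the Gaussian moment generating function kernel `t ↦ exp (c t² / 2)`.
[folklore] -/
theorem hasDerivAt_exp_mul_sq_div_two (c t : ℝ) :
    HasDerivAt (fun t : ℝ ↦ Real.exp (c * t ^ 2 / 2)) (c * t * Real.exp (c * t ^ 2 / 2)) t := by
  have hsq : HasDerivAt (fun x : ℝ ↦ x ^ 2) (2 * t) t :=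
    (hasDerivAt_pow 2 t).congr_deriv (by norm_num)
  have h1 : HasDerivAt (fun t : ℝ ↦ c * t ^ 2 / 2) (c * t) t :=
    ((hsq.const_mul c).div_const 2).congr_deriv (by ring)
  exact h1.exp.congr_deriv (by ring)

/-- Differentiating `u(t) exp(c t²/2)` gives `(u'(t) + c t u(t)) exp(c t²/2)`. [folklore] -/
theorem deriv_mul_exp_mul_sq_div_two {u u' : ℝ → ℝ} (hu : ∀ t, HasDerivAt u (u' t) t) (c : ℝ) :
    deriv (fun t ↦ u t * Real.exp (c * t ^ 2 / 2))
      = fun t ↦ (u' t + c * t * u t) * Real.exp (c * t ^ 2 / 2) := by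
  funext t
  rw [((hu t).fun_mul (hasDerivAt_exp_mul_sq_div_two c t)).deriv]
  ring

/-- The fourth derivative at `0` of `t ↦ exp (c t² / 2)` is `3 c²`. [folklore] -/
theorem iteratedDeriv_four_exp_mul_sq_div_two (c : ℝ) :
    iteratedDeriv 4 (fun t : ℝ ↦ Real.exp (c * t ^ 2 / 2)) 0 = 3 * c ^ 2 := by
  have hsq : ∀ t : ℝ, HasDerivAt (fun x : ℝ ↦ x ^ 2) (2 * t) t := fun t ↦
    (hasDerivAt_pow 2 t).congr_deriv (by norm_num)
  have hcube : ∀ t : ℝ, HasDerivAt (fun x : ℝ ↦ x ^ 3) (3 * t ^ 2) t := fun t ↦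
    (hasDerivAt_pow 3 t).congr_deriv (by norm_num)
  have e0 : (fun t : ℝ ↦ Real.exp (c * t ^ 2 / 2)) = fun t ↦ (fun _ ↦ (1 : ℝ)) t *
      Real.exp (c * t ^ 2 / 2) := by
    funext t; simp
  have hu0 : ∀ t : ℝ, HasDerivAt (fun _ : ℝ ↦ (1 : ℝ)) ((fun _ ↦ (0 : ℝ)) t) t :=
    fun t ↦ hasDerivAt_const t 1
  have hu1 : ∀ t : ℝ, HasDerivAt (fun t : ℝ ↦ c * t) ((fun _ ↦ c) t) t := fun t ↦
    hasDerivAt_const_mul c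
  have hu2 : ∀ t : ℝ, HasDerivAt (fun t : ℝ ↦ c + c ^ 2 * t ^ 2) ((fun t ↦ 2 * c ^ 2 * t) t) t :=
    fun t ↦ (((hsq t).const_mul (c ^ 2)).const_add c).congr_deriv (by ring)
  have hu3 : ∀ t : ℝ, HasDerivAt (fun t : ℝ ↦ 3 * c ^ 2 * t + c ^ 3 * t ^ 3)
      ((fun t ↦ 3 * c ^ 2 + 3 * c ^ 3 * t ^ 2) t) t := fun t ↦
    ((hasDerivAt_const_mul (3 * c ^ 2)).fun_add ((hcube t).const_mul (c ^ 3))).congr_deriv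
      (by ring)
  rw [show (4 : ℕ) = 0 + 1 + 1 + 1 + 1 from rfl]
  simp only [iteratedDeriv_succ, iteratedDeriv_zero]
  rw [e0, deriv_mul_exp_mul_sq_div_two hu0]
  have e1 : (fun t : ℝ ↦ ((fun _ ↦ (0 : ℝ)) t + c * t * (fun _ ↦ (1 : ℝ)) t) *
      Real.exp (c * t ^ 2 / 2)) = fun t ↦ (fun t ↦ c * t) t * Real.exp (c * t ^ 2 / 2) := by
    funext t; simp
  rw [e1, deriv_mul_exp_mul_sq_div_two hu1]
  have e2 : (fun t : ℝ ↦ ((fun _ ↦ c) t + c * t * (fun t ↦ c * t) t) * Real.exp (c * t ^ 2 / 2))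
      = fun t ↦ (fun t ↦ c + c ^ 2 * t ^ 2) t * Real.exp (c * t ^ 2 / 2) := by
    funext t; ring_nf
  rw [e2, deriv_mul_exp_mul_sq_div_two hu2]
  have e3 : (fun t : ℝ ↦ ((fun t ↦ 2 * c ^ 2 * t) t + c * t * (fun t ↦ c + c ^ 2 * t ^ 2) t) *
      Real.exp (c * t ^ 2 / 2))
      = fun t ↦ (fun t ↦ 3 * c ^ 2 * t + c ^ 3 * t ^ 3) t * Real.exp (c * t ^ 2 / 2) := by
    funext t; ring_nf
  rw [e3, deriv_mul_exp_mul_sq_div_two hu3]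
  simp

/-- **Fourth moment of a centred Gaussian**: `∫ x ^ 4 d(gaussianReal 0 v) = 3 v²`
(via the fourth derivative at `0` of the moment generating function `t ↦ exp (v t² / 2)`).
Degenne–Ledvinka–Marion–Pfaffelhuber, arXiv:2511.20118, §2.4 / §5 (moments `(2n-1)!! vⁿ`).
[folklore] -/
theorem integral_pow_four_gaussianReal (v : ℝ≥0) :
    ∫ x, x ^ 4 ∂gaussianReal 0 v = 3 * (v : ℝ) ^ 2 := by
  have h := iteratedDeriv_mgf_zero (X := id) (μ := gaussianReal 0 v)
    (by simp [integrableExpSet_id_gaussianReal]) 4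
  simp only [Pi.pow_apply, id_eq] at h
  rw [← h, mgf_id_gaussianReal]
  simp only [zero_mul, zero_add]
  exact iteratedDeriv_four_exp_mul_sq_div_two v

/-- The fourth absolute moment of a centred Gaussian as a Lebesgue integral:
`∫⁻ ‖x‖ₑ ^ 4 d(gaussianReal 0 v) = ENNReal.ofReal (3 v²)`. [folklore] -/
theorem lintegral_enorm_rpow_four_gaussianReal (v : ℝ≥0) :
    ∫⁻ x, ‖x‖ₑ ^ (4 : ℝ) ∂gaussianReal 0 v = ENNReal.ofReal (3 * (v : ℝ) ^ 2) := by
  have hint : Integrable (fun x : ℝ ↦ x ^ 4) (gaussianReal 0 v) := by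
    simpa using integrable_pow_of_mem_interior_integrableExpSet (X := id) (μ := gaussianReal 0 v)
      (by simp [integrableExpSet_id_gaussianReal]) 4
  have h4 : ∀ x : ℝ, ‖x‖ₑ ^ (4 : ℝ) = ENNReal.ofReal (x ^ 4) := by
    intro x
    rw [Real.enorm_eq_ofReal_abs, ENNReal.ofReal_rpow_of_nonneg (abs_nonneg x) (by norm_num),
      show (4 : ℝ) = ((4 : ℕ) : ℝ) by norm_num, Real.rpow_natCast, Even.pow_abs (by decide)]
  simp_rw [h4]
  rw [← ofReal_integral_eq_lintegral_ofReal hint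
    (ae_of_all _ fun x ↦ (Even.pow_nonneg (by decide) x)), integral_pow_four_gaussianReal]

end Literature.Probability.Process

namespace ProbabilityTheory

/-! ### Kolmogorov–Chentsov: discharge of the named facts -/

section KolmogorovChentsov

variable {Ω E : Type*} {mΩ : MeasurableSpace Ω} [EMetricSpace E]
  [MeasurableSpace E] {p q : ℝ} {M : ℝ≥0} {P : Measure Ω} {X : ℝ≥0 → Ω → E}

/-- The named fact `IsKolmogorovProcess.exists_modification_continuous` (Kolmogorov–Chentsov
continuity theorem on `ℝ≥0`, continuity part) holds: it is
`Literature.Probability.Process.exists_modification_continuous_of_isKolmogorovProcess` (dyadic proof, Le Gall 2016, Thm 2.9;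
Kallenberg 2002, Thm 3.23; arXiv:2511.20118, Thm 4.21). [cite: Legall2016, Thm 2.9] -/
theorem IsKolmogorovProcess.exists_modification_continuous_holds :
    IsKolmogorovProcess.exists_modification_continuous (X := X) (P := P) (p := p) (q := q)
      (M := M) := by
  intro _ _ hX hq
  exact Literature.Probability.Process.exists_modification_continuous_of_isKolmogorovProcess hX hq

/-- The named fact `IsAEKolmogorovProcess.exists_modification_continuous` holds unconditionally
(the conditional discharge `…_holds` of `BrownianMotion.lean` fed with
`IsKolmogorovProcess.exists_modification_continuous_holds`).
Kallenberg, *Foundations* (2002), Thm 3.23. [cite: Kallenberg2002, Thm 3.23] -/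
theorem IsAEKolmogorovProcess.exists_modification_continuous_holds' :
    IsAEKolmogorovProcess.exists_modification_continuous (X := X) (P := P) (p := p) (q := q)
      (M := M) :=
  IsAEKolmogorovProcess.exists_modification_continuous_holds
    fun _ ↦ IsKolmogorovProcess.exists_modification_continuous_holds

end KolmogorovChentsov

/-! ### Pre-Brownian motion: Kolmogorov condition and continuous modification -/

section PreBrownian

variable {Ω : Type*} {mΩ : MeasurableSpace Ω} {X : ℝ≥0 → Ω → ℝ} {P : Measure Ω}

/-- The named fact `IsPreBrownianReal.isAEKolmogorovProcess` holds: a pre-Brownian motion is a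
modification (take measurable representatives of the a.e.-measurable marginals) of a process
satisfying the Kolmogorov condition with `p = 4`, `q = 2`, `M = 3`, because
`X s - X t ∼ 𝓝(0, |s - t|)` has fourth moment `3 |s - t|²`.
Le Gall 2016, proof of Cor 2.11; arXiv:2511.20118, §2.4. [cite: Legall2016, Cor 2.11] -/
theorem IsPreBrownianReal.isAEKolmogorovProcess_holds :
    IsPreBrownianReal.isAEKolmogorovProcess (X := X) (P := P) := by
  intro hX
  set Y : ℝ≥0 → Ω → ℝ := fun t ↦ (hX.aemeasurable t).mk (X t) with hYdef
  have hY : ∀ t, X t =ᵐ[P] Y t := fun t ↦ (hX.aemeasurable t).ae_eq_mk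
  refine ⟨Y, IsKolmogorovProcess.mk_of_secondCountableTopology
    (fun t ↦ (hX.aemeasurable t).measurable_mk) (fun s t ↦ ?_) (by norm_num) (by norm_num), hY⟩
  calc ∫⁻ ω, edist (Y s ω) (Y t ω) ^ (4 : ℝ) ∂P
      = ∫⁻ ω, ‖(X s - X t) ω‖ₑ ^ (4 : ℝ) ∂P := by
        refine lintegral_congr_ae ?_
        filter_upwards [hY s, hY t] with ω h1 h2
        rw [← h1, ← h2, edist_eq_enorm_sub, Pi.sub_apply]
    _ = ∫⁻ x, ‖x‖ₑ ^ (4 : ℝ) ∂gaussianReal 0 (nndist (s : ℝ) (t : ℝ)) :=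
        (hX.hasLaw_sub s t).lintegral_comp (f := fun x : ℝ ↦ ‖x‖ₑ ^ (4 : ℝ)) (by fun_prop)
    _ = ENNReal.ofReal (3 * ((nndist (s : ℝ) (t : ℝ) : ℝ≥0) : ℝ) ^ 2) :=
        Literature.Probability.Process.lintegral_enorm_rpow_four_gaussianReal _
    _ ≤ ((3 : ℝ≥0) : ℝ≥0∞) * edist s t ^ (2 : ℝ) := by
        apply le_of_eq
        rw [coe_nndist, Real.dist_eq, edist_dist, NNReal.dist_eq,
          ENNReal.ofReal_rpow_of_nonneg (abs_nonneg _) (by norm_num),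
          show (2 : ℝ) = ((2 : ℕ) : ℝ) by norm_num, Real.rpow_natCast,
          ENNReal.ofReal_mul (by norm_num)]
        norm_num

/-- The named fact `IsPreBrownianReal.exists_modification_isBrownianReal` holds: every
pre-Brownian motion `X` (under a probability measure) has a modification `B` which is a Brownian
motion with *everywhere* continuous paths, measurable marginals and `B 0 = 0` identically.
Proof: Kolmogorov–Chentsov (`IsAEKolmogorovProcess.exists_modification_continuous_holds'`)
applied to `IsPreBrownianReal.isAEKolmogorovProcess_holds` gives a continuous measurable
modification `Y`; then `B t := Y t - Y 0` (recall `Y 0 = X 0 = 0` a.s.).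
Le Gall 2016, Cor 2.11 and Def 2.12; Degenne–Ledvinka–Marion–Pfaffelhuber, arXiv:2511.20118, §5
(`IsPreBrownian.mk`); Kallenberg 2002, Thm 13.5. [cite: Legall2016, Cor 2.11] -/
theorem IsPreBrownianReal.exists_modification_isBrownianReal_holds :
    IsPreBrownianReal.exists_modification_isBrownianReal (X := X) (P := P) := by
  intro _ hX
  have hK : IsAEKolmogorovProcess X P 4 2 3 := IsPreBrownianReal.isAEKolmogorovProcess_holds hX
  obtain ⟨Y, hYX, hYm, hYc⟩ :=
    IsAEKolmogorovProcess.exists_modification_continuous_holds' (X := X) (P := P) hK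
      (by norm_num)
  set B : ℝ≥0 → Ω → ℝ := fun t ω ↦ Y t ω - Y 0 ω with hBdef
  have hY0 : ∀ᵐ ω ∂P, Y 0 ω = 0 := by
    filter_upwards [hYX 0, hX.eval_zero_ae_eq_zero] with ω h1 h2
    rw [h1, h2]
  have hB : ∀ t, X t =ᵐ[P] B t := by
    intro t
    filter_upwards [hYX t, hY0] with ω h1 h2
    simp [hBdef, h2, h1]
  refine ⟨B, hB, ⟨hX.congr hB, ae_of_all _ fun ω ↦ ?_⟩, fun t ↦ (hYm t).sub (hYm 0),
    fun ω ↦ ?_, fun ω ↦ sub_self _⟩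
  · exact (hYc ω).sub continuous_const
  · exact (hYc ω).sub continuous_const

end PreBrownian

end ProbabilityTheory
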